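import Literature.NumberTheory.EllipticCurves.Kato2004.IwasawaH1Reduction
import HarnessLib

/-!
# `H¹_cont` along a short exact sequence of topological modules whose kernel is a CLOSED EMBEDDING:
# exactness at `H¹` of the middle term, and injectivity of `H¹` of the kernel when invariants lift
# (proofs; arbitrary — e.g. profinite — coefficients)

Topic `NumberTheory/GaloisRepresentations` (namespace = path).  `Proofs`-style file: theorems only, no
definition, no named fact, no `sorry`, no instance.  Cell `bsd-potss`, seat `bsd-potss-rkm` (g8): the
piece of the long exact cohomology sequence used for Kato's (14.14.1)
(`0 → 𝐇¹(T)/a𝐇¹(T) → H¹(ℤ[1/p],T) → …`, Astérisque 295 p. 243: "an exact sequence … by the argument as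
in 13.8", i.e. the cohomology sequence of `0 → T ⊗ Λ →(a) T ⊗ Λ → T → 0`), for coefficient modules
that are NOT discrete — the tree's `IsSES` toolkit (`ContinuousCohomologyConnecting.lean`) covers the
discrete case only.

For a topological group `G`, topological representations `X₁, X₂ : TopRep R G`, `X₃ : TopRep R' G`
(the coefficient rings may differ, as for `T ⊗ Λ` over `ℤ` versus `T_pW` over `ℤ_p`) and additive,
continuous, `G`-equivariant maps `f : X₁ → X₂`, `g : X₂ → X₃` with `ker g ⊆ range f` — the shape of
the tree's `mapH1AddHom` (`Kato2004/IwasawaH1Reduction.lean`, `H¹` is functorial along such maps):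

* `mapH1AddHom_injective_of_forall_exists_invariant` — if `f` is injective, `g ∘ f = 0` and every
  `G`-invariant of `X₃` lifts to a `G`-invariant of `X₂` (surjectivity of `X₂^G → X₃^G`, i.e. the
  connecting map `δ₀ : X₃^G → H¹(G, X₁)` vanishes), then `H¹(f) : H¹(G, X₁) → H¹(G, X₂)` is injective.
* `exists_mapH1AddHom_eq_of_mapH1AddHom_eq_zero` — if `f` is a topological EMBEDDING, `g` is
  surjective and the orbit maps `σ ↦ σ·w` of `X₂` are continuous, then
  `H¹(G, X₁) →(H¹ f) H¹(G, X₂) →(H¹ g) H¹(G, X₃)` is exact at `H¹(G, X₂)` (a class killed by `H¹(g)`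
  comes from `H¹(G, X₁)`): on cocycles, `ψ − ∂w` takes values in `range f` and `f⁻¹ ∘ (ψ − ∂w)` is
  continuous because `f` is an embedding.

These are Serre, *Cohomologie galoisienne* I §2.2 (the cohomology exact sequence) in degree `≤ 1`
for continuous cochains with topological coefficients (Tate 1976 §2; NSW II §7), with no
discreteness and no local-compactness hypothesis.

## References

* J.-P. Serre, *Galois Cohomology* (1997), I §2.2. [SerreGaloisCohomology1997]
* J. Neukirch, A. Schmidt, K. Wingberg, *Cohomology of Number Fields* (2008), II §7 (continuous
  cochain cohomology of topological modules), (2.7.2). [NeukirchSchmidtWingberg2008]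
* K. Kato, Astérisque 295 (2004), §13.8 (p. 228), §14.14 (p. 243). [Kato2004Asterisque]
* Tree: `ContinuousH1.lean` (`contOneCocycles`, `oneCocycleClass`, `oneCocycleClass_eq_zero_iff`),
  `Kato2004/IwasawaH1Reduction.lean` (`mapH1AddHom`), `ContinuousCohomologyConnecting.lean` (the
  discrete `IsSES` analogue `exists_map_one_eq_of_map_one_eq_zero`).
-/

noncomputable section

open CategoryTheory Topology

universe u u' v

namespace Literature.NumberTheory.GaloisRepresentations

variable {R : Type u} [Ring R] [TopologicalSpace R] {R' : Type u'} [Ring R'] [TopologicalSpace R']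
variable {G : Type v} [Group G] [TopologicalSpace G] [IsTopologicalGroup G]
variable {X₁ X₂ : TopRep.{v} R G} {X₃ : TopRep.{v} R' G}
variable (f : X₁ →+ X₂) (hf : Continuous f) (hfρ : ∀ (σ : G) (x : X₁), f (X₁.ρ σ x) = X₂.ρ σ (f x))
variable (g : X₂ →+ X₃) (hg : Continuous g)

/-- **Injectivity of `H¹(f)` when invariants lift.**  Let `f : X₁ → X₂`, `g : X₂ → X₃` be additive
continuous equivariant maps with `f` injective, `g ∘ f = 0` and `ker g ⊆ range f`.  If every
`G`-invariant element of `X₃` is the image of a `G`-invariant element of `X₂`, then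
`H¹(f) : H¹_cont(G, X₁) → H¹_cont(G, X₂)` is injective (exactness of
`X₂^G → X₃^G →(δ₀) H¹(G, X₁) →(H¹ f) H¹(G, X₂)` with `δ₀ = 0`).
[cite: SerreGaloisCohomology1997, I §2.2] -/
theorem mapH1AddHom_injective_of_forall_exists_invariant (hfi : Function.Injective f)
    (hgρ : ∀ (σ : G) (x : X₂), g (X₂.ρ σ x) = X₃.ρ σ (g x))
    (hgf : ∀ x, g (f x) = 0) (hexact : ∀ y, g y = 0 → ∃ x, f x = y)
    (hlift : ∀ v : X₃, (∀ σ : G, X₃.ρ σ v = v) → ∃ w : X₂, (∀ σ : G, X₂.ρ σ w = w) ∧ g w = v) :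
    Function.Injective (mapH1AddHom X₁ X₂ f hf hfρ) := by
  refine (injective_iff_map_eq_zero _).2 fun x hx => ?_
  obtain ⟨φ, rfl⟩ := oneCocycleClass_surjective _ x
  rw [mapH1AddHom_oneCocycleClass, oneCocycleClass_eq_zero_iff] at hx
  obtain ⟨w, hw⟩ := hx
  have hw' : ∀ σ, f (φ.1 σ) = X₂.ρ σ w - w := fun σ => hw σ
  -- `g w` is invariant
  have hgw : ∀ σ : G, X₃.ρ σ (g w) = g w := fun σ => by
    rw [← sub_eq_zero, ← hgρ, ← map_sub, ← hw', hgf]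
  obtain ⟨w', hw'inv, hgw'⟩ := hlift (g w) hgw
  -- `w - w' ∈ ker g = range f`
  obtain ⟨m, hm⟩ := hexact (w - w') (by rw [map_sub, hgw', sub_self])
  rw [oneCocycleClass_eq_zero_iff]
  refine ⟨m, fun σ => hfi ?_⟩
  rw [hw', map_sub, hfρ, hm, map_sub, hw'inv]
  abel

/-- **Exactness at `H¹(G, X₂)` for a closed-embedding kernel.**  Let `f : X₁ → X₂` be an additive
equivariant topological EMBEDDING, `g : X₂ → X₃` additive continuous equivariant and surjective with
`ker g ⊆ range f`, and assume the orbit maps `σ ↦ σ·w` of `X₂` are continuous (e.g. a jointly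
continuous action).  Then every class of `H¹_cont(G, X₂)` killed by `H¹(g)` is in the image of
`H¹(f)`: if `g ∘ ψ = ∂v`, lift `v` to `w`, so `ψ − ∂w` has values in `range f`, and `f⁻¹ ∘ (ψ − ∂w)`
is a CONTINUOUS crossed homomorphism because `f` is an embedding.
[cite: SerreGaloisCohomology1997, I §2.2] [cite: NeukirchSchmidtWingberg2008, II §7] -/
theorem exists_mapH1AddHom_eq_of_mapH1AddHom_eq_zero (hfe : IsEmbedding f)
    (hgρ : ∀ (σ : G) (x : X₂), g (X₂.ρ σ x) = X₃.ρ σ (g x))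
    (hgs : Function.Surjective g) (hexact : ∀ y, g y = 0 → ∃ x, f x = y)
    (hX₂ : ∀ w : X₂, Continuous fun σ : G => X₂.ρ σ w)
    (y : continuousCohomology 1 X₂) (hy : mapH1AddHom X₂ X₃ g hg hgρ y = 0) :
    ∃ x : continuousCohomology 1 X₁, mapH1AddHom X₁ X₂ f hf hfρ x = y := by
  obtain ⟨ψ, rfl⟩ := oneCocycleClass_surjective _ y
  rw [mapH1AddHom_oneCocycleClass, oneCocycleClass_eq_zero_iff] at hy
  obtain ⟨v, hv⟩ := hy
  have hv' : ∀ σ, g (ψ.1 σ) = X₃.ρ σ v - v := fun σ => hv σ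
  obtain ⟨w, hw⟩ := hgs v
  -- the corrected cochain `ψ' = ψ − ∂w` takes values in `ker g ⊆ range f`
  have hker : ∀ σ, g (ψ.1 σ - (X₂.ρ σ w - w)) = 0 := fun σ => by
    rw [map_sub, map_sub, hv', hgρ, hw, sub_self]
  have hrange : ∀ σ, ψ.1 σ - (X₂.ρ σ w - w) ∈ Set.range f := fun σ => by
    obtain ⟨x, hx⟩ := hexact _ (hker σ)
    exact ⟨x, hx⟩
  -- `f⁻¹ ∘ ψ'` via the homeomorphism `X₁ ≃ₜ range f`
  let e := hfe.toHomeomorph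
  have hcont : Continuous fun σ : G => ψ.1 σ - (X₂.ρ σ w - w) :=
    ψ.1.continuous.sub ((hX₂ w).sub continuous_const)
  let φfun : G → X₁ := fun σ => e.symm ⟨ψ.1 σ - (X₂.ρ σ w - w), hrange σ⟩
  have hφcont : Continuous φfun := e.symm.continuous.comp (hcont.subtype_mk _)
  have hfφ : ∀ σ, f (φfun σ) = ψ.1 σ - (X₂.ρ σ w - w) := fun σ => by
    have h := congrArg (fun z : Set.range f => (z : X₂)) (e.apply_symm_apply ⟨_, hrange σ⟩)
    simpa only [e, IsEmbedding.toHomeomorph_apply_coe] using h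
  let φ : contOneCocycles X₁ := ⟨⟨φfun, hφcont⟩, fun σ τ => hfe.injective (by
    change f (φfun (σ * τ)) = f (φfun σ + X₁.ρ σ (φfun τ))
    rw [map_add, hfρ, hfφ, hfφ, hfφ, ψ.2 σ τ, ρ_mul_apply, map_sub, map_sub]
    abel)⟩
  refine ⟨oneCocycleClass _ φ, ?_⟩
  rw [mapH1AddHom_oneCocycleClass, eq_comm, ← sub_eq_zero, ← oneCocycleClass_sub,
    oneCocycleClass_eq_zero_iff]
  refine ⟨w, fun σ => ?_⟩
  change ψ.1 σ - f (φfun σ) = X₂.ρ σ w - w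
  rw [hfφ, sub_sub_cancel]

end Literature.NumberTheory.GaloisRepresentations

end
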